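import Summits.PneNP.PneNP.Theorems.RegularResolutionRung.Negative.OneSidedFalse

/-!
# Route RamseyUncertifiable, crux `RegularResolutionRung` (stmt-PneNP-9818), line `sound-path-bottleneck`:
# paths in a resolution DAG (persistence of literals) and the clause families of `cliqueCNF`

Auxiliary file 2 for the registered stub `stub_soundPathCount` (the bottleneck count of
Atserias–Bonacina–de Rezende–Lauria–Nordström–Razborov, arXiv:2012.09476 §6, under the modified path
distribution `D*`). Deterministic facts about a valid derivation `π` (tree `Resolution.lean`) read along a
DAG path `p` (conclusions → premises):

* `premise_step`: a premise is an earlier line, and a literal of the premise survives into the conclusion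
  unless its variable is the pivot there (`E = C.erase (v,true) ∪ D.erase (v,false)`; weakening ⊆);
* `dagPath_isChain_gt` / `dagPath_pairwise_gt`: indices strictly decrease along a DAG path;
* `persistence_mono` (MONO: a literal present at position `t` is present at position `0` or its variable
  is a pivot met on `p.take t`) and `persistence_indelible` (INDELIBLE, needs `IsRegular`: a variable
  pivoted on `p.take t` whose literal is present at the END of the path is present at position `t`), for
  either polarity, with node-indexed corollaries `mono_nodes`, `indelible_nodes` (ABdRLNR p. 15);
* `decodeVar` (variable `i·m+v ↦ (i,v)`) and `mem_cliqueCNF_cases` (the three clause families).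

Several proofs are adapted from the sibling skeleton `Cruxes/RegularResolutionRung/Lines/indelible-zero-banks.lean`
(positive literals there). No propositions are defined; the registered sub-goal `spc_dag_anchor` (closed
form of `persistence_indelible`) credits the file. [folklore]
-/

set_option linter.dupNamespace false -- `Summit.PneNP.PneNP.…`: single-conjunct summit

namespace Summit.PneNP.PneNP.Cruxes.RegularResolutionRung.SoundPathBottleneck

open Literature.Computability.MetaComplexity Literature.Computability.Complexity
open Summit.PneNP.PneNP.Theorems.RegularResolutionRung.Negative (cliqueCNF)

/-! ## One step of a valid derivation -/

section Dag

variable {φ : CNF ℕ} {π : List (ResLine ℕ)}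

-- adapted from Cruxes/RegularResolutionRung/Lines/indelible-zero-banks.lean (`premise_step`, positive literals)
/-- One step of a valid derivation: a premise `b` of line `a` is an earlier line, and a literal of the
premise survives into line `a` unless its variable is the pivot of line `a` (either polarity). -/
theorem premise_step (hπ : IsResDerivation φ π) {a : ℕ} (ha : a < π.length) {b : ℕ}
    (hb : b ∈ (π[a]).premises) :
    ∃ hba : b < a, ∀ l : Literal ℕ, l ∈ (π[b]'(hba.trans ha)).clause →
      l ∈ (π[a]).clause ∨ (π[a]).rule.pivot? = some l.1 := by
  have hv := hπ a ha
  unfold IsValidResLine at hv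
  unfold ResLine.premises at hb
  split at hv
  · next heq => rw [heq] at hb; simp [ResRule.premises] at hb
  · next i j v heq =>
    obtain ⟨hi, hj, hC, hD, hE⟩ := hv
    have hi' : i < a := by have := hi; simp at this; exact this.1
    have hj' : j < a := by have := hj; simp at this; exact this.1
    rw [heq] at hb
    simp only [ResRule.premises, List.mem_cons, List.not_mem_nil, or_false] at hb
    simp only [List.getElem_take] at hC hD hE
    rcases hb with rfl | rfl
    · refine ⟨hi', fun l hl => ?_⟩
      by_cases hlv : l = (v, true)
      · right; rw [heq, hlv]; rfl
      · left; rw [hE]; exact Finset.mem_union_left _ (Finset.mem_erase.2 ⟨hlv, hl⟩)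
    · refine ⟨hj', fun l hl => ?_⟩
      by_cases hlv : l = (v, false)
      · right; rw [heq, hlv]; rfl
      · left; rw [hE]; exact Finset.mem_union_right _ (Finset.mem_erase.2 ⟨hlv, hl⟩)
  · next i heq =>
    obtain ⟨hi, hsub⟩ := hv
    have hi' : i < a := by have := hi; simp at this; exact this.1
    rw [heq] at hb
    simp only [ResRule.premises, List.mem_cons, List.not_mem_nil, or_false] at hb
    subst hb
    simp only [List.getElem_take] at hsub
    exact ⟨hi', fun l hl => Or.inl (hsub hl)⟩

/-! ## DAG paths: indices, successors, monotonicity -/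

/-- Entries of a DAG path are line indices. -/
theorem dagPath_lt {p : List ℕ} (hp : IsDagPath (π.map ResLine.premises) p) {t : ℕ}
    (ht : t < p.length) : p[t] < π.length := by
  have := hp.1 (p[t]) (List.getElem_mem _); simpa using this

/-- Members of a DAG path are line indices. -/
theorem dagPath_mem_lt {p : List ℕ} (hp : IsDagPath (π.map ResLine.premises) p) {a : ℕ}
    (ha : a ∈ p) : a < π.length := by
  have := hp.1 a ha; simpa using this

/-- Consecutive entries of a DAG path: the next entry is a premise of the current one. -/
theorem dagPath_succ {p : List ℕ} (hp : IsDagPath (π.map ResLine.premises) p) {t : ℕ}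
    (ht : t + 1 < p.length) :
    p[t + 1] ∈ (π[p[t]]'(dagPath_lt hp (by omega))).premises := by
  have hrel := List.isChain_iff_getElem.1 hp.2 t ht
  have hlt : p[t] < π.length := dagPath_lt hp (by omega)
  rw [List.getD_eq_getElem?_getD, List.getElem?_map, List.getElem?_eq_getElem hlt] at hrel
  simpa using hrel

/-- Prefixes of DAG paths are DAG paths. -/
theorem dagPath_take {p : List ℕ} (hp : IsDagPath (π.map ResLine.premises) p) (t : ℕ) :
    IsDagPath (π.map ResLine.premises) (p.take t) :=
  ⟨fun i hi => hp.1 i (List.mem_of_mem_take hi), hp.2.take t⟩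

/-- Along a DAG path of a valid derivation the line indices strictly decrease. -/
theorem dagPath_isChain_gt (hπ : IsResDerivation φ π) {p : List ℕ}
    (hp : IsDagPath (π.map ResLine.premises) p) : p.IsChain (fun a b => b < a) := by
  refine List.IsChain.imp_of_mem_imp (fun a b ha _ hab => ?_) hp.2
  have haπ : a < π.length := dagPath_mem_lt hp ha
  have : (π.map ResLine.premises).getD a [] = (π[a]).premises := by
    simp [List.getD_eq_getElem?_getD, haπ]
  rw [this] at hab
  exact (premise_step hπ haπ hab).1

/-- … hence they are pairwise strictly decreasing. -/
theorem dagPath_pairwise_gt (hπ : IsResDerivation φ π) {p : List ℕ}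
    (hp : IsDagPath (π.map ResLine.premises) p) : p.Pairwise (fun a b => b < a) := by
  let _inst : Trans (fun a b : ℕ => b < a) (fun a b : ℕ => b < a) (fun a b : ℕ => b < a) :=
    ⟨fun h₁ h₂ => lt_trans h₂ h₁⟩
  exact (dagPath_isChain_gt hπ hp).pairwise

/-- In a pairwise strictly decreasing list, a member larger than the entry at position `t` sits before
position `t`. -/
theorem mem_take_of_gt {p : List ℕ} (hpw : p.Pairwise (fun a b => b < a)) {t : ℕ} (ht : t < p.length)
    {a : ℕ} (ha : a ∈ p) (hgt : p[t] < a) : a ∈ p.take t := by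
  obtain ⟨s, hs, rfl⟩ := List.getElem_of_mem ha
  rw [List.mem_take_iff_getElem]
  refine ⟨s, ?_, rfl⟩
  rw [lt_min_iff]
  refine ⟨?_, hs⟩
  by_contra hts
  push Not at hts
  rcases Nat.lt_or_eq_of_le hts with hlt | heq
  · have := List.pairwise_iff_getElem.1 hpw t s ht hs hlt
    omega
  · subst heq; exact lt_irrefl _ hgt

/-- In a pairwise strictly decreasing list, positions are ordered like the entries (reversed). -/
theorem idx_lt_of_gt {p : List ℕ} (hpw : p.Pairwise (fun a b => b < a)) {s t : ℕ} (hs : s < p.length)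
    (ht : t < p.length) (hgt : p[t] < p[s]) : s < t := by
  by_contra hts
  push Not at hts
  rcases Nat.lt_or_eq_of_le hts with hlt | heq
  · have := List.pairwise_iff_getElem.1 hpw t s ht hs hlt
    omega
  · subst heq; exact lt_irrefl _ hgt

/-- In a pairwise strictly decreasing list, positions are weakly ordered like the entries (reversed). -/
theorem idx_le_of_ge {p : List ℕ} (hpw : p.Pairwise (fun a b => b < a)) {s t : ℕ} (hs : s < p.length)
    (ht : t < p.length) (hge : p[t] ≤ p[s]) : s ≤ t := by
  by_contra hts
  push Not at hts
  have := List.pairwise_iff_getElem.1 hpw t s ht hs hts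
  omega

/-! ## Pivots along a path -/

/-- Membership in `pivotsAlong`: some line of the list is a resolution step on `x`. -/
theorem mem_pivotsAlong_iff {q : List ℕ} {x : ℕ} :
    x ∈ pivotsAlong π q ↔ ∃ a ∈ q, ∃ ha : a < π.length, (π[a]).rule.pivot? = some x := by
  unfold pivotsAlong
  rw [List.mem_filterMap]
  constructor
  · rintro ⟨a, ha, h⟩
    rcases Nat.lt_or_ge a π.length with hlt | hge
    · rw [List.getElem?_eq_getElem hlt] at h
      exact ⟨a, ha, hlt, by simpa using h⟩
    · rw [List.getElem?_eq_none_iff.2 hge] at h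
      simp at h
  · rintro ⟨a, ha, hlt, h⟩
    exact ⟨a, ha, by rw [List.getElem?_eq_getElem hlt]; simpa using h⟩

-- adapted from Cruxes/RegularResolutionRung/Lines/indelible-zero-banks.lean
/-- The pivot met at position `t` lies in `pivotsAlong π (p.take (t+1))`. -/
theorem mem_pivotsAlong_take_succ {p : List ℕ} {t : ℕ} (ht : t < p.length) (hπt : p[t] < π.length)
    {x : ℕ} (hx : (π[p[t]]).rule.pivot? = some x) : x ∈ pivotsAlong π (p.take (t + 1)) := by
  rw [mem_pivotsAlong_iff]
  exact ⟨p[t], by rw [List.mem_take_iff_getElem]; exact ⟨t, by simp [ht], rfl⟩, hπt, hx⟩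

/-- `pivotsAlong` is monotone along prefixes (adapted from the sibling skeleton, like the next lemma). -/
theorem pivotsAlong_take_mono {p : List ℕ} {s t : ℕ} (hst : s ≤ t) {x : ℕ}
    (hx : x ∈ pivotsAlong π (p.take s)) : x ∈ pivotsAlong π (p.take t) := by
  unfold pivotsAlong at hx ⊢
  rw [List.mem_filterMap] at hx ⊢
  obtain ⟨i, hi, h⟩ := hx
  exact ⟨i, (List.take_sublist_take_left hst).subset hi, h⟩

/-- Regularity forbids meeting, at position `t`, a pivot already met on the prefix `p.take t`. -/
theorem not_pivot_again (hreg : IsRegular π) {p : List ℕ} (hp : IsDagPath (π.map ResLine.premises) p)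
    {t : ℕ} (ht : t < p.length) {x : ℕ}
    (hx : x ∈ pivotsAlong π (p.take t)) (hpt : (π[p[t]]'(dagPath_lt hp ht)).rule.pivot? = some x) :
    False := by
  have hnd := hreg p hp
  have hsplit : pivotsAlong π p = pivotsAlong π (p.take t) ++ pivotsAlong π (p.drop t) := by
    unfold pivotsAlong
    rw [← List.filterMap_append, List.take_append_drop]
  rw [hsplit, List.nodup_append] at hnd
  obtain ⟨-, -, hdis⟩ := hnd
  have hx2 : x ∈ pivotsAlong π (p.drop t) := by
    rw [mem_pivotsAlong_iff]
    refine ⟨p[t], ?_, dagPath_lt hp ht, hpt⟩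
    rw [List.drop_eq_getElem_cons ht]
    exact List.mem_cons_self
  exact hdis x hx x hx2 rfl

/-! ## Persistence of literals (either polarity) -/

-- adapted from Cruxes/RegularResolutionRung/Lines/indelible-zero-banks.lean (`persistence_mono`)
/-- MONO: reading conclusions → premises, a literal is gained only at a pivot on its variable. -/
theorem persistence_mono (hπ : IsResDerivation φ π) {p : List ℕ}
    (hp : IsDagPath (π.map ResLine.premises) p) (l : Literal ℕ) :
    ∀ (t : ℕ) (ht : t < p.length),
      l ∈ (π[p[t]]'(dagPath_lt hp ht)).clause →
      l ∈ (π[p[0]]'(dagPath_lt hp (by omega))).clause ∨ l.1 ∈ pivotsAlong π (p.take t) := by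
  intro t
  induction t with
  | zero => intro ht h; exact Or.inl h
  | succ t ih =>
    intro ht h
    have hprem := dagPath_succ hp ht
    obtain ⟨hba, hstep⟩ := premise_step hπ (dagPath_lt hp (by omega)) hprem
    rcases hstep l h with h' | hpiv
    · rcases ih (by omega) h' with h0 | hx
      · exact Or.inl h0
      · exact Or.inr (pivotsAlong_take_mono (Nat.le_succ t) hx)
    · exact Or.inr (mem_pivotsAlong_take_succ (by omega) (dagPath_lt hp (by omega)) hpiv)

-- adapted from Cruxes/RegularResolutionRung/Lines/indelible-zero-banks.lean (`persistence_indelible`)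
/-- INDELIBLE: under regularity, a variable pivoted on `p.take t` whose literal is present at the end of
the path is present at position `t`. -/
theorem persistence_indelible (hπ : IsResDerivation φ π) (hreg : IsRegular π) {p : List ℕ}
    (hp : IsDagPath (π.map ResLine.premises) p) (l : Literal ℕ) (hne : 0 < p.length)
    (hend : l ∈ (π[p[p.length - 1]]'(dagPath_lt hp (by omega))).clause) :
    ∀ (d t : ℕ) (ht : t < p.length), p.length - 1 = t + d →
      l.1 ∈ pivotsAlong π (p.take t) → l ∈ (π[p[t]]'(dagPath_lt hp ht)).clause := by
  intro d
  induction d with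
  | zero =>
    intro t ht he hx
    have : t = p.length - 1 := by omega
    subst this
    exact hend
  | succ d ih =>
    intro t ht he hx
    have ht1 : t + 1 < p.length := by omega
    have hnext := ih (t + 1) ht1 (by omega) (pivotsAlong_take_mono (Nat.le_succ t) hx)
    have hprem := dagPath_succ hp ht1
    obtain ⟨hba, hstep⟩ := premise_step hπ (dagPath_lt hp ht) hprem
    rcases hstep l hnext with h' | hpiv
    · exact h'
    · exact (not_pivot_again hreg hp ht hx hpiv).elim

/-- MONO by nodes: a literal present at a node `a` of the path but not at its start was pivoted (on its
variable) at an EARLIER node of the path (a larger index). -/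
theorem mono_nodes (hπ : IsResDerivation φ π) {p : List ℕ} (hp : IsDagPath (π.map ResLine.premises) p)
    {a : ℕ} (ha : a ∈ p) {l : Literal ℕ} (hl : l ∈ (π[a]'(dagPath_mem_lt hp ha)).clause)
    (h0 : ∀ h0 : 0 < p.length, l ∉ (π[p[0]]'(dagPath_lt hp h0)).clause) :
    ∃ a₁ ∈ p, a < a₁ ∧ ∃ h₁ : a₁ < π.length, (π[a₁]).rule.pivot? = some l.1 := by
  obtain ⟨t, ht, rfl⟩ := List.getElem_of_mem ha
  rcases persistence_mono hπ hp l t ht hl with h | h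
  · exact (h0 (by omega) h).elim
  · rw [mem_pivotsAlong_iff] at h
    obtain ⟨a₁, ha₁, h₁, hpiv⟩ := h
    obtain ⟨s, hs, rfl⟩ := List.getElem_of_mem ha₁
    rw [List.length_take] at hs
    simp only [List.getElem_take] at hpiv
    refine ⟨p[s], List.getElem_mem _, ?_, dagPath_lt hp (by omega), hpiv⟩
    exact List.pairwise_iff_getElem.1 (dagPath_pairwise_gt hπ hp) s t (by omega) ht (by omega)

/-- INDELIBLE by nodes: if `x` is the pivot at a node `a₁` of the path, `a₂` is a later node (smaller
index) and `a₃` a node not before `a₂`, then a literal on `x` present at `a₃` is present at `a₂`. -/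
theorem indelible_nodes (hπ : IsResDerivation φ π) (hreg : IsRegular π) {p : List ℕ}
    (hp : IsDagPath (π.map ResLine.premises) p) {a₁ a₂ a₃ : ℕ} (h₁ : a₁ ∈ p) (h₂ : a₂ ∈ p)
    (h₃ : a₃ ∈ p) (h12 : a₂ < a₁) (h23 : a₃ ≤ a₂) {l : Literal ℕ}
    (hx : (π[a₁]'(dagPath_mem_lt hp h₁)).rule.pivot? = some l.1)
    (hl : l ∈ (π[a₃]'(dagPath_mem_lt hp h₃)).clause) : l ∈ (π[a₂]'(dagPath_mem_lt hp h₂)).clause := by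
  have hpw := dagPath_pairwise_gt hπ hp
  obtain ⟨t₁, ht₁, rfl⟩ := List.getElem_of_mem h₁
  obtain ⟨t₂, ht₂, rfl⟩ := List.getElem_of_mem h₂
  obtain ⟨t₃, ht₃, rfl⟩ := List.getElem_of_mem h₃
  have h12' : t₁ < t₂ := idx_lt_of_gt hpw ht₁ ht₂ h12
  have h23' : t₂ ≤ t₃ := idx_le_of_ge hpw ht₂ ht₃ h23
  -- restrict to the prefix ending at position t₃
  set p' := p.take (t₃ + 1) with hp'
  have hp'path : IsDagPath (π.map ResLine.premises) p' := dagPath_take hp _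
  have hlen : p'.length = t₃ + 1 := by rw [hp', List.length_take]; omega
  have hlast : p'[p'.length - 1]'(by rw [hlen]; omega) = p[t₃] := by
    simp only [hp', List.getElem_take, List.length_take]
    congr 1
    omega
  have ht2' : p'[t₂]'(by rw [hlen]; omega) = p[t₂] := by simp [hp', List.getElem_take]
  have hpiv : l.1 ∈ pivotsAlong π (p'.take t₂) := by
    have : p'.take t₂ = p.take t₂ := by rw [hp', List.take_take, min_eq_left (by omega)]
    rw [this]
    exact pivotsAlong_take_mono (Nat.succ_le_of_lt h12') (mem_pivotsAlong_take_succ ht₁ (dagPath_lt hp ht₁) hx)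
  have hend : l ∈ (π[p'[p'.length - 1]'(by rw [hlen]; omega)]'(dagPath_lt hp'path (by rw [hlen]; omega))).clause := by
    simp only [hlast]; exact hl
  have := persistence_indelible hπ hreg hp'path l (by rw [hlen]; omega) hend (t₃ - t₂) t₂
    (by rw [hlen]; omega) (by rw [hlen]; omega) hpiv
  simp only [ht2'] at this
  exact this

end Dag

/-! ## Block variables and the clause families of `cliqueCNF` -/

section Clauses

/-- Decode a variable `x` into (block, vertex) `(x / m, x % m)` when it is a block variable `x < k·m`. -/
def decodeVar (k m x : ℕ) : Option (Fin k × Fin m) :=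
  if h : x < k * m then
    some (⟨x / m, Nat.div_lt_of_lt_mul (by rwa [Nat.mul_comm] at h)⟩,
      ⟨x % m, Nat.mod_lt _ (Nat.pos_of_ne_zero fun hm => by simp [hm] at h)⟩)
  else none

/-- `decodeVar` inverts the encoding `(i, v) ↦ i·m + v`. -/
theorem decodeVar_encode {k m : ℕ} (i : Fin k) (v : Fin m) :
    decodeVar k m (i * m + v) = some (i, v) := by
  have hv := v.isLt
  have hlt : (i : ℕ) * m + v < k * m := by
    have := Nat.mul_le_mul_right m (Nat.succ_le_of_lt i.isLt)
    rw [Nat.succ_mul] at this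
    omega
  unfold decodeVar
  rw [dif_pos hlt]
  have hd := Summit.PneNP.PneNP.Theorems.RegularResolutionRung.Negative.digits_of (s := (i : ℕ)) hv
  simp only [Option.some.injEq, Prod.mk.injEq, Fin.ext_iff]
  exact ⟨hd.1, hd.2⟩

/-- `decodeVar` is a left inverse of the encoding: a decoded variable is the encoded pair. -/
theorem eq_of_decodeVar_eq_some {k m x : ℕ} {i : Fin k} {v : Fin m}
    (h : decodeVar k m x = some (i, v)) : x = i * m + v := by
  unfold decodeVar at h
  split_ifs at h with hx
  simp only [Option.some.injEq, Prod.mk.injEq, Fin.ext_iff] at h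
  obtain ⟨hi, hv⟩ := h
  rw [← hi, ← hv]
  exact (Nat.div_add_mod' x m).symm

/-- A variable that does not decode is not a block variable. -/
theorem decodeVar_eq_none_iff {k m x : ℕ} : decodeVar k m x = none ↔ k * m ≤ x := by
  unfold decodeVar
  split_ifs with h
  · exact ⟨fun h' => (by cases h'), fun h' => absurd h (not_lt.2 h')⟩
  · exact ⟨fun _ => not_lt.1 h, fun _ => rfl⟩

-- adapted from Cruxes/RegularResolutionRung/Lines/indelible-zero-banks.lean (`mem_coeList_iff`)
/-- Membership in the coerced vertex list `↑(List.finRange n) : List ℕ` appearing in `cliqueCNF`. -/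
theorem mem_coeList_iff {n : ℕ} {a : ℕ} :
    (a ∈ (do let v ← List.finRange n; pure (v : ℕ) : List ℕ)) ↔ a < n := by
  simp only [List.bind_eq_flatMap, List.pure_def, List.mem_flatMap, List.mem_finRange, true_and,
    List.mem_singleton]
  constructor
  · rintro ⟨v, rfl⟩; exact v.isLt
  · intro h; exact ⟨⟨a, h⟩, rfl⟩

-- adapted from Cruxes/RegularResolutionRung/Lines/indelible-zero-banks.lean (`mem_cliqueCNF_cases`)
/-- The three clause families of `cliqueCNF`, unfolded. -/
theorem mem_cliqueCNF_cases {n k : ℕ} {adj : Fin n → Fin n → Bool} {c : Clause ℕ}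
    (hc : c ∈ cliqueCNF n k adj) :
    (∃ i < k, c = (do let v ← List.finRange n; pure (v : ℕ) : List ℕ).map fun v => (i * n + v, true)) ∨
    (∃ i < k, ∃ u < n, ∃ v < n, u < v ∧ c = [(i * n + u, false), (i * n + v, false)]) ∨
    (∃ i < k, ∃ j < k, ∃ u v : Fin n, i ≠ j ∧ adj u v = false ∧
      c = [(i * n + (u : ℕ), false), (j * n + (v : ℕ), false)]) := by
  unfold cliqueCNF at hc
  simp only [List.mem_append, List.mem_map, List.mem_flatMap, List.mem_range, List.mem_finRange,
    true_and] at hc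
  rcases hc with (⟨i, hi, rfl⟩ | ⟨i, hi, u, hu, v, hv, hc⟩) | ⟨i, hi, j, hj, u, v, hc⟩
  · exact Or.inl ⟨i, hi, rfl⟩
  · rw [mem_coeList_iff] at hu hv
    by_cases huv : u < v
    · rw [if_pos huv, List.mem_singleton] at hc
      exact Or.inr (Or.inl ⟨i, hi, u, hu, v, hv, huv, hc⟩)
    · rw [if_neg huv] at hc; simp at hc
  · by_cases h : i ≠ j ∧ adj u v = false
    · rw [if_pos h, List.mem_singleton] at hc
      exact Or.inr (Or.inr ⟨i, hi, j, hj, u, v, h.1, h.2, hc⟩)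
    · rw [if_neg h] at hc; simp at hc

/-- Membership in the block clause of block `i`, as a finset of literals. -/
theorem mem_blockClause_toFinset_iff {n i : ℕ} {l : Literal ℕ} :
    l ∈ ((do let v ← List.finRange n; pure (v : ℕ) : List ℕ).map fun v => (i * n + v, true)).toFinset ↔
      ∃ v < n, l = (i * n + v, true) := by
  rw [List.mem_toFinset, List.mem_map]
  constructor
  · rintro ⟨v, hv, rfl⟩; exact ⟨v, mem_coeList_iff.1 hv, rfl⟩
  · rintro ⟨v, hv, rfl⟩; exact ⟨v, mem_coeList_iff.2 hv, rfl⟩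

end Clauses

/-- Registered sub-goal `spc_dag_anchor` of stmt-PneNP-9818 (credits this auxiliary file): the closed form of
`persistence_indelible`. -/
theorem spc_dag_anchor : ∀ (φ : CNF ℕ) (π : List (ResLine ℕ)) (p : List ℕ),
    IsResDerivation φ π → IsRegular π → IsDagPath (π.map ResLine.premises) p →
    ∀ (l : Literal ℕ) (t : ℕ) (ht : t < p.length) (hₜ : p[t] < π.length) (hₑ : p[p.length - 1] < π.length),
    l.1 ∈ pivotsAlong π (p.take t) → l ∈ (π[p[p.length - 1]]).clause → l ∈ (π[p[t]]).clause :=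
  fun _ _ p hπ hreg hp l t ht _ _ hx hend =>
    persistence_indelible hπ hreg hp l (by omega) hend (p.length - 1 - t) t ht (by omega) hx

end Summit.PneNP.PneNP.Cruxes.RegularResolutionRung.SoundPathBottleneck
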